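import Literature.AnabelianGeometry.EtaleTheta.Discharge.Sec1Def17Coverings
import Literature.AnabelianGeometry.EtaleTheta.Discharge.Sec1StandardValuesModel
import HarnessLib

/-!
# [EtTh] §1, Def. 1.7 / Def. 1.9: `Π^tp_Ẋ/Π^tp_Ÿ ≅ ℤ` — a GENERATOR of the orbit group of `η̈^{Θ,ℤ}`
# (discharge of GAP row G-L2t6g4-3, binder (B2) of `Discharge/Sec1StandardValuesModel.lean`)

S. Mochizuki, *The étale theta function and its Frobenioid-theoretic manifestations*, Publ. RIMS **45**
(2009), §1: Def. 1.7, PRIMS PDF p. 27 (printed 253) — «`Ẍ^log → X^log` … the Galois covering of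
degree 4 determined by the multiplication by 2 map», «`ε_μ ∈ Gal(Ẍ/X)` … the unique nontrivial element
… that acts trivially on the set of irreducible components of the special fiber», «a nontrivial element
`ε_Z ∈ Gal(Ẍ/X)` which is `≠ ε_μ`», «`Ẍ^log → Ẋ^log` is the quotient by the action of `ε_Z`» — and
Def. 1.9, p. 29 (printed 255): «write `η̈^{Θ,ℤ}` for the `Π^tp_Ẋ/Π^tp_Ÿ ≅ ℤ`-orbit of `η̈^Θ`»
[cite: MochizukiEtTh2009, Def 1.7 p.27]. Layer L2 of the abc-iut cell, seat abc-iut-L2-t6 (gen 4).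
PROOF-ONLY (no `def`) over abc-iut-L2-t1's `ConstantMultipleRigidity.lean` (`MuTwoSetting`, `dotX`,
`IsAdmissibleEpsZ`) and `Discharge/Sec1Def17Coverings.lean` (`mem_dotX_iff`, `GtpXdd_eq_normalClosure`,
`relIndex_GtpYdd_GtpY`, `index_comap_toZ_two`) BY NAME.

The interface `MuTwoSetting` records `ε_μ` only as «a nontrivial element of `Gal(Ẍ/X)`» (its printed
characterisation is not typed), so an admissible `ε_Z` may be ANY of the other two nontrivial elements,
and `Π^tp_Ẋ/Π^tp_Ÿ` need not be cyclic in the interface. This file proves, by group theory over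
`toZ : Π^tp_X ↠ ℤ = Gal(Y/X)`:
* `toZ_even_of_mem_GtpXdd` — `Π^tp_Ẍ ⊆ toZ⁻¹(2ℤ)` (`Π^tp_Ẍ` is the normal closure of `Π^tp_Ÿ` and the
  squares; `Ẍ → X` factors through the double covering of `X` inside `Y`);
* `GtpXdd_inf_GtpY_eq_GtpYdd` — **`Π^tp_Ẍ ∩ Π^tp_Y = Π^tp_Ÿ`** (index count: `[Π^tp_Y : Π^tp_Ÿ] = 2`,
  `[Π^tp_X : Π^tp_Ẍ] = 4`);
* `odd_toZ_of_isAdmissibleEpsZ` — the printed characterisation of `ε_μ`, read as «`toZ` of a lift of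
  `ε_μ` is EVEN» (it acts trivially on the two components of the special fibre of `Ẍ`, i.e. trivially on
  `Gal(Y′/X) = ℤ/2ℤ`), implies that a lift `σ_Z` of any ADMISSIBLE `ε_Z` has ODD `toZ(σ_Z)`
  (`toZ⁻¹(2ℤ) = Π^tp_Ẍ ⊔ ⟨ε_μ⟩`);
* **`exists_orbit_generator`** — for a lift `σ_Z` with odd `toZ`: there is `σ₁ ∈ Π^tp_Ẋ` with
  `toZ(σ₁) = 1` such that EVERY `σ ∈ Π^tp_X` with `inclX σ ∈ Π^tp_Ẋ` is `σ₁^a · h`, `h ∈ Π^tp_Ÿ` — the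
  binder (B2)/`hgen` of `MuTwoSetting.thetaOrbit_eq_range_conj_zpow` (p418439), i.e.
  `Π^tp_Ẋ/Π^tp_Ÿ ≅ ℤ` generated by `σ₁`; packaged as `thetaOrbit_eq_range_conj_zpow_of_odd`.
So GAP row G-L2t6g4-3 is CLOSED modulo the single printed sentence characterising `ε_μ` (binder
`hμ : Even (toZ μ̃)`), resp. directly modulo «`toZ(σ_Z)` odd».
HONEST FRAMING: typed ≠ proved for [EtTh]; nothing here bears on the disputed [IUTchIII] Cor. 3.12.
-/

namespace Literature.AnabelianGeometry.EtaleTheta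

open Literature.AnabelianGeometry.SemiGraphs

namespace MuTwoSetting

variable {p : ℕ} [Fact p.Prime] (M : MuTwoSetting p)

/-! ### `Π^tp_Ẍ ⊆ toZ⁻¹(2ℤ)` and `Π^tp_Ẍ ∩ Π^tp_Y = Π^tp_Ÿ` -/

/-- The index-`2` subgroup `toZ⁻¹(2ℤ) ≤ Π^tp_X` (the double covering `Y′ → X` inside `Y → X`) contains
`Π^tp_Ẍ`: `Π^tp_Ẍ` is the normal closure of `Π^tp_Ÿ ⊆ Ker toZ` and the squares (`GtpXdd_eq_normalClosure`),
both of even `toZ`. («`Ẍ → X` determined by the multiplication by `2` map», p. 27: it factors through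
`Y′`.) [cite: MochizukiEtTh2009, Def 1.7 p.27] -/
theorem GtpXdd_le_comap_toZ_two :
    M.GtpXdd ≤ (AddSubgroup.zmultiples (2 : ℤ)).toSubgroup.comap M.toZ := by
  set P := (AddSubgroup.zmultiples (2 : ℤ)).toSubgroup.comap M.toZ with hP
  haveI : P.Normal := Subgroup.Normal.comap inferInstance M.toZ
  rw [M.GtpXdd_eq_normalClosure]
  apply Subgroup.normalClosure_le_normal
  rintro x (hx | ⟨g, rfl⟩)
  · have hx' : M.toZ x = 1 := by
      have h := M.GtpYdd_le_GtpY hx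
      change x ∈ M.toZ.ker at h
      exact (MonoidHom.mem_ker).mp h
    simp only [hP, SetLike.mem_coe, Subgroup.mem_comap, Multiplicative.mem_toSubgroup, hx', toAdd_one]
    exact zero_mem _
  · simp only [hP, SetLike.mem_coe, Subgroup.mem_comap, Multiplicative.mem_toSubgroup, map_mul,
      toAdd_mul, Int.mem_zmultiples_iff]
    exact ⟨Multiplicative.toAdd (M.toZ g), by ring⟩

/-- `toZ(g)` is EVEN for `g ∈ Π^tp_Ẍ`. [cite: MochizukiEtTh2009, Def 1.7 p.27] -/
theorem toZ_even_of_mem_GtpXdd {g : M.PiTemp} (hg : g ∈ M.GtpXdd) :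
    Even (Multiplicative.toAdd (M.toZ g)) := by
  have h := M.GtpXdd_le_comap_toZ_two hg
  simp only [Subgroup.mem_comap, Multiplicative.mem_toSubgroup, Int.mem_zmultiples_iff] at h
  obtain ⟨k, hk⟩ := h
  exact ⟨k, by rw [hk]; ring⟩

/-- An element `t ∈ Π^tp_X` with `toZ(t) = 1` (a lift of the generator of `Gal(Y/X) = ℤ`).
[cite: MochizukiEtTh2009, §1 p.12] -/
theorem exists_toZ_eq_one : ∃ t : M.PiTemp, Multiplicative.toAdd (M.toZ t) = 1 := by
  obtain ⟨t, ht⟩ := M.toZ_surjective (Multiplicative.ofAdd 1)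
  exact ⟨t, by rw [ht, toAdd_ofAdd]⟩

/-- `toZ⁻¹(2ℤ) = Π^tp_Y ⊔ ⟨t²⟩` for `toZ(t) = 1`: every element of even `toZ` is `(t²)^k` times an
element of `Π^tp_Y`. [cite: MochizukiEtTh2009, §1 p.12] -/
theorem mem_GtpY_mul_of_toZ_even {t g : M.PiTemp} (ht : Multiplicative.toAdd (M.toZ t) = 1)
    {k : ℤ} (hk : Multiplicative.toAdd (M.toZ g) = 2 * k) :
    g * ((t * t) ^ k)⁻¹ ∈ M.GtpY := by
  change g * ((t * t) ^ k)⁻¹ ∈ M.toZ.ker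
  rw [MonoidHom.mem_ker]
  apply Multiplicative.toAdd.injective
  simp only [map_mul, map_inv, map_zpow, toAdd_mul, toAdd_inv, toAdd_zpow, toAdd_one, smul_eq_mul,
    ht, hk]
  ring

/-- **`Π^tp_Ẍ ∩ Π^tp_Y = Π^tp_Ÿ`** («`Ÿ^log → Ẍ^log`» is the `ℤ`-covering and `Ẍ ∩ Y`-level is `Ÿ`):
`Π^tp_Ÿ ≤ Π^tp_Ẍ ∩ Π^tp_Y ≤ Π^tp_Y` with `[Π^tp_Y : Π^tp_Ÿ] = 2`, and `Π^tp_Y ≤ Π^tp_Ẍ` is impossible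
(it would force `toZ⁻¹(2ℤ) = Π^tp_Y · {squares} ≤ Π^tp_Ẍ`, of index `2 ≠ 4`).
[cite: MochizukiEtTh2009, Def 1.7 p.27] -/
theorem GtpXdd_inf_GtpY_eq_GtpYdd : M.GtpXdd ⊓ M.GtpY = M.GtpYdd := by
  set A := M.GtpXdd ⊓ M.GtpY with hA
  have hYddA : M.GtpYdd ≤ A := le_inf M.GtpYdd_le_GtpXdd M.GtpYdd_le_GtpY
  have hAY : A ≤ M.GtpY := inf_le_right
  -- `Π^tp_Y ≤ Π^tp_Ẍ` is impossible
  have hne : ¬ M.GtpY ≤ M.GtpXdd := by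
    intro hle
    obtain ⟨t, ht⟩ := M.exists_toZ_eq_one
    -- then `toZ⁻¹(2ℤ) ≤ Π^tp_Ẍ`
    have hP : (AddSubgroup.zmultiples (2 : ℤ)).toSubgroup.comap M.toZ ≤ M.GtpXdd := by
      intro g hg
      simp only [Subgroup.mem_comap, Multiplicative.mem_toSubgroup, Int.mem_zmultiples_iff] at hg
      obtain ⟨k, hk⟩ := hg
      have hy : g * ((t * t) ^ k)⁻¹ ∈ M.GtpY := M.mem_GtpY_mul_of_toZ_even ht hk
      have hsq : (t * t) ^ k ∈ M.GtpXdd := M.GtpXdd.zpow_mem (M.mul_self_mem_GtpXdd t) k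
      have : g = g * ((t * t) ^ k)⁻¹ * (t * t) ^ k := by group
      rw [this]
      exact M.GtpXdd.mul_mem (hle hy) hsq
    have h2 : M.GtpXdd.index ∣ 2 := by
      rw [← M.index_comap_toZ_two]
      exact Subgroup.index_dvd_of_le hP
    rw [M.index_GtpXdd] at h2
    omega
  -- hence `[Π^tp_Y : A] ≠ 1`, so `= 2`, so `A = Π^tp_Ÿ`
  have hprod : M.GtpYdd.relIndex A * A.relIndex M.GtpY = 2 := by
    rw [Subgroup.relIndex_mul_relIndex M.GtpYdd A M.GtpY hYddA hAY, M.relIndex_GtpYdd_GtpY]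
  have hA1 : A.relIndex M.GtpY ≠ 1 := by
    intro h1
    rw [Subgroup.relIndex_eq_one] at h1
    exact hne (le_trans h1 inf_le_left)
  have hdvd : A.relIndex M.GtpY ∣ 2 := ⟨M.GtpYdd.relIndex A, by rw [mul_comm]; exact hprod.symm⟩
  have hA2 : A.relIndex M.GtpY = 2 := by
    rcases (Nat.dvd_prime Nat.prime_two).mp hdvd with h | h
    · exact absurd h hA1
    · exact h
  have hYdd1 : M.GtpYdd.relIndex A = 1 := by
    rw [hA2] at hprod
    omega
  exact le_antisymm (Subgroup.relIndex_eq_one.mp hYdd1) hYddA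

/-! ### The printed characterisation of `ε_μ` forces `toZ(ε_Z)` odd -/

/-- For `N ⊴ G` and `e` with `e² ∈ N`: `g ∈ N ⊔ ⟨e⟩ ↔ g ∈ N ∨ g e⁻¹ ∈ N`. [folklore] -/
private theorem mem_sup_zpowers_iff_of_mul_self_mem' {G : Type*} [Group G] {N : Subgroup G} [N.Normal]
    {e : G} (he : e * e ∈ N) {g : G} : g ∈ N ⊔ Subgroup.zpowers e ↔ g ∈ N ∨ g * e⁻¹ ∈ N := by
  constructor
  · intro hg
    have hg' : g ∈ ((N ⊔ Subgroup.zpowers e : Subgroup G) : Set G) := hg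
    rw [Subgroup.normal_mul] at hg'
    obtain ⟨n, hn, z, hz, rfl⟩ := Set.mem_mul.mp hg'
    obtain ⟨k, rfl⟩ := Subgroup.mem_zpowers_iff.mp hz
    have he2 : e ^ (2 : ℤ) ∈ N := by rw [zpow_two]; exact he
    obtain ⟨j, r, hr, rfl⟩ : ∃ j r : ℤ, (r = 0 ∨ r = 1) ∧ k = 2 * j + r :=
      ⟨k / 2, k % 2, by omega, by omega⟩
    rcases hr with rfl | rfl
    · left
      rw [add_zero, zpow_mul]
      exact N.mul_mem hn (N.zpow_mem he2 j)
    · right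
      rw [zpow_add, zpow_mul, zpow_one, ← mul_assoc, mul_inv_cancel_right]
      exact N.mul_mem hn (N.zpow_mem he2 j)
  · rintro (hg | hg)
    · exact Subgroup.mem_sup_left hg
    · have : g = g * e⁻¹ * e := by group
      rw [this]
      exact mul_mem (Subgroup.mem_sup_left hg) (Subgroup.mem_sup_right (Subgroup.mem_zpowers e))

/-- **`toZ⁻¹(2ℤ) = Π^tp_Ẍ ⊔ ⟨μ̃⟩`** for a lift `μ̃ ∈ Π^tp_X` of `ε_μ` with EVEN `toZ(μ̃)` (print: `ε_μ` acts
trivially on the set of irreducible components of the special fibre of `Ẍ`, i.e. trivially on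
`Gal(Y′/X)`): `Π^tp_Ẍ < Π^tp_Ẍ ⊔ ⟨μ̃⟩ ≤ toZ⁻¹(2ℤ)` with indices `4` and `2`.
[cite: MochizukiEtTh2009, Def 1.7 p.27] -/
theorem comap_toZ_two_eq_sup {μ : M.PiTemp} (hμX : M.inclX μ = M.epsMu)
    (hμ : Even (Multiplicative.toAdd (M.toZ μ))) :
    (AddSubgroup.zmultiples (2 : ℤ)).toSubgroup.comap M.toZ = M.GtpXdd ⊔ Subgroup.zpowers μ := by
  set P := (AddSubgroup.zmultiples (2 : ℤ)).toSubgroup.comap M.toZ with hP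
  set Q := M.GtpXdd ⊔ Subgroup.zpowers μ with hQ
  have hμP : μ ∈ P := by
    obtain ⟨k, hk⟩ := hμ
    simp only [hP, Subgroup.mem_comap, Multiplicative.mem_toSubgroup, Int.mem_zmultiples_iff]
    exact ⟨k, by rw [hk]; ring⟩
  have hQP : Q ≤ P := sup_le M.GtpXdd_le_comap_toZ_two (Subgroup.zpowers_le.2 hμP)
  have hμnot : μ ∉ M.GtpXdd := fun h => M.epsMu_not_mem ⟨μ, h, hμX⟩
  -- indices: `[Π^tp_X : Q]` divides `4`, is divisible by `2`, and is not `4`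
  have hXQ : M.GtpXdd ≤ Q := le_sup_left
  have hQidx_dvd : Q.index ∣ 4 := by
    rw [← M.index_GtpXdd]; exact Subgroup.index_dvd_of_le hXQ
  have h2dvd : 2 ∣ Q.index := by
    rw [← M.index_comap_toZ_two]; exact Subgroup.index_dvd_of_le hQP
  have hQne : Q.index ≠ 4 := by
    intro h4
    have hrel : M.GtpXdd.relIndex Q * Q.index = M.GtpXdd.index := Subgroup.relIndex_mul_index hXQ
    rw [h4, M.index_GtpXdd] at hrel
    have h1 : M.GtpXdd.relIndex Q = 1 := by omega
    rw [Subgroup.relIndex_eq_one] at h1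
    exact hμnot (h1 (Subgroup.mem_sup_right (Subgroup.mem_zpowers μ)))
  have hQ2 : Q.index = 2 := by
    obtain ⟨c, hc⟩ := h2dvd
    have hc2 : c ∣ 2 := by
      have h : 2 * c ∣ 2 * 2 := by simpa [hc] using hQidx_dvd
      exact Nat.dvd_of_mul_dvd_mul_left (by norm_num) h
    rcases (Nat.dvd_prime Nat.prime_two).mp hc2 with rfl | rfl
    · simpa using hc
    · exact absurd (by simpa using hc) hQne
  -- containment with equal finite index
  have hrel : Q.relIndex P * P.index = Q.index := Subgroup.relIndex_mul_index hQP
  rw [hQ2, M.index_comap_toZ_two] at hrel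
  have h1 : Q.relIndex P = 1 := by omega
  exact le_antisymm (Subgroup.relIndex_eq_one.mp h1) hQP

/-- **Admissible `ε_Z` has a lift of ODD `toZ`**, granted the printed characterisation of `ε_μ` (even
`toZ` of a lift `μ̃`): otherwise `σ_Z ∈ toZ⁻¹(2ℤ) = Π^tp_Ẍ ∪ Π^tp_Ẍ·μ̃`, contradicting
«`ε_Z` nontrivial, `≠ ε_μ`» (`IsAdmissibleEpsZ`). [cite: MochizukiEtTh2009, Def 1.7 p.27] -/
theorem odd_toZ_of_isAdmissibleEpsZ {εZ : M.GtpC} (hZ : M.IsAdmissibleEpsZ εZ)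
    {σZ : M.PiTemp} (hσZ : M.inclX σZ = εZ) {μ : M.PiTemp} (hμX : M.inclX μ = M.epsMu)
    (hμ : Even (Multiplicative.toAdd (M.toZ μ))) : Odd (Multiplicative.toAdd (M.toZ σZ)) := by
  rcases Int.even_or_odd (Multiplicative.toAdd (M.toZ σZ)) with heven | hodd
  · exfalso
    obtain ⟨_, hZ2, hZ3⟩ := hZ
    have hσP : σZ ∈ (AddSubgroup.zmultiples (2 : ℤ)).toSubgroup.comap M.toZ := by
      obtain ⟨k, hk⟩ := heven
      simp only [Subgroup.mem_comap, Multiplicative.mem_toSubgroup, Int.mem_zmultiples_iff]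
      exact ⟨k, by rw [hk]; ring⟩
    rw [M.comap_toZ_two_eq_sup hμX hμ] at hσP
    haveI := M.GtpXdd_normal
    rcases (mem_sup_zpowers_iff_of_mul_self_mem' (M.mul_self_mem_GtpXdd μ)).mp hσP with h | h
    · exact hZ2 ⟨σZ, h, hσZ⟩
    · exact hZ3 ⟨σZ * μ⁻¹, h, by rw [map_mul, map_inv, hσZ, hμX]⟩
  · exact hodd

/-! ### The generator of `Π^tp_Ẋ/Π^tp_Ÿ ≅ ℤ` -/

variable {M}

/-- Membership in `Π^tp_Ẋ` pulled back to `Π^tp_X`: `inclX σ ∈ dotX εZ ↔ σ ∈ Π^tp_Ẍ ∨ σ σ_Z⁻¹ ∈ Π^tp_Ẍ`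
for a lift `σ_Z` of `ε_Z`. [cite: MochizukiEtTh2009, Def 1.7 p.27] -/
theorem inclX_mem_dotX_iff {εZ : M.GtpC} {σZ : M.PiTemp} (hσZ : M.inclX σZ = εZ) (σ : M.PiTemp) :
    M.inclX σ ∈ M.dotX εZ ↔ σ ∈ M.GtpXdd ∨ σ * σZ⁻¹ ∈ M.GtpXdd := by
  rw [M.mem_dotX_iff εZ (M.inclX σ), ← hσZ, ← map_inv, ← map_mul,
    Subgroup.mem_map_iff_mem M.injective_inclX, Subgroup.mem_map_iff_mem M.injective_inclX]

/-- **`Π^tp_Ẋ/Π^tp_Ÿ ≅ ℤ` is generated by one element** («write `η̈^{Θ,ℤ}` for the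
`Π^tp_Ẋ/Π^tp_Ÿ ≅ ℤ`-orbit of `η̈^Θ`», p. 255): for `ε_Z` with a lift `σ_Z ∈ Π^tp_X` of ODD `toZ` (every
admissible `ε_Z`: `odd_toZ_of_isAdmissibleEpsZ`), there is `σ₁ ∈ Π^tp_X` with `inclX σ₁ ∈ Π^tp_Ẋ` and `toZ(σ₁) = 1`
such that every `σ` with `inclX σ ∈ Π^tp_Ẋ` is `σ₁^a · h` with `h ∈ Π^tp_Ÿ` (`a = toZ(σ)`). This is
the binder (B2)/`hgen` of `thetaOrbit_eq_range_conj_zpow` (p418439; GAP row G-L2t6g4-3).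
[cite: MochizukiEtTh2009, Def 1.9 p.29] -/
theorem exists_orbit_generator {εZ : M.GtpC} {σZ : M.PiTemp}
    (hσZ : M.inclX σZ = εZ) (hodd : Odd (Multiplicative.toAdd (M.toZ σZ))) :
    ∃ σ₁ : M.PiTemp, M.inclX σ₁ ∈ M.dotX εZ ∧ Multiplicative.toAdd (M.toZ σ₁) = 1 ∧
      ∀ σ : M.PiTemp, M.inclX σ ∈ M.dotX εZ →
        ∃ (a : ℤ) (h : M.PiTemp), h ∈ M.toThetaSetting.GtpYdd ∧ σ = σ₁ ^ a * h := by
  obtain ⟨m, hm⟩ := hodd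
  obtain ⟨t, ht⟩ := M.exists_toZ_eq_one
  have hsq : (t * t) ^ m ∈ M.GtpXdd := M.GtpXdd.zpow_mem (M.mul_self_mem_GtpXdd t) m
  set σ₁ : M.PiTemp := σZ * ((t * t) ^ m)⁻¹ with hσ₁
  have hσ₁Z : Multiplicative.toAdd (M.toZ σ₁) = 1 := by
    simp only [hσ₁, map_mul, map_inv, map_zpow, toAdd_mul, toAdd_inv, toAdd_zpow, smul_eq_mul, ht, hm]
    ring
  have hσ₁X : M.inclX σ₁ ∈ M.dotX εZ := by
    rw [hσ₁, map_mul, map_inv]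
    refine (M.dotX εZ).mul_mem ?_ ((M.dotX εZ).inv_mem (M.map_GtpXdd_le_dotX εZ ⟨_, hsq, rfl⟩))
    rw [hσZ]
    exact Subgroup.mem_sup_right (Subgroup.mem_zpowers εZ)
  refine ⟨σ₁, hσ₁X, hσ₁Z, fun σ hσ => ?_⟩
  set a : ℤ := Multiplicative.toAdd (M.toZ σ) with ha
  refine ⟨a, (σ₁ ^ a)⁻¹ * σ, ?_, by group⟩
  -- `h := σ₁^{-a} σ` has `toZ(h) = 0` and lies in `Π^tp_Ẋ`
  have hh0 : Multiplicative.toAdd (M.toZ ((σ₁ ^ a)⁻¹ * σ)) = 0 := by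
    simp only [map_mul, map_inv, map_zpow, toAdd_mul, toAdd_inv, toAdd_zpow, hσ₁Z, smul_eq_mul, ← ha]
    ring
  have hhY : (σ₁ ^ a)⁻¹ * σ ∈ M.GtpY := by
    change (σ₁ ^ a)⁻¹ * σ ∈ M.toZ.ker
    rw [MonoidHom.mem_ker]
    apply Multiplicative.toAdd.injective
    rw [hh0, toAdd_one]
  have hhX : M.inclX ((σ₁ ^ a)⁻¹ * σ) ∈ M.dotX εZ := by
    rw [map_mul, map_inv, map_zpow]
    exact (M.dotX εZ).mul_mem ((M.dotX εZ).inv_mem ((M.dotX εZ).zpow_mem hσ₁X a)) hσ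
  rcases (inclX_mem_dotX_iff hσZ _).mp hhX with h | h
  · -- `h ∈ Π^tp_Ẍ ∩ Π^tp_Y = Π^tp_Ÿ`
    rw [← M.GtpXdd_inf_GtpY_eq_GtpYdd]
    exact ⟨h, hhY⟩
  · -- `h σ_Z⁻¹ ∈ Π^tp_Ẍ` has even `toZ`, but `toZ(h σ_Z⁻¹) = −toZ(σ_Z)` is odd
    exfalso
    obtain ⟨k, hk⟩ := M.toZ_even_of_mem_GtpXdd h
    rw [map_mul, map_inv, toAdd_mul, toAdd_inv, hh0, hm] at hk
    omega

/-- **The orbit `η̈^{Θ,ℤ}` through the generator** (p418439's `thetaOrbit_eq_range_conj_zpow` with its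
binder (B2) discharged): for `ε_Z` with a lift of odd `toZ`, some `σ₁ ∈ Π^tp_Ẋ` with
`toZ(σ₁) = 1` has `η̈^{Θ,ℤ} = {conj(σ₁^a) x | a ∈ ℤ}`. [cite: MochizukiEtTh2009, Def 1.9 p.29] -/
theorem thetaOrbit_eq_range_conj_zpow_of_odd (hC : M.toThetaSetting.Compat) {εZ : M.GtpC}
    {σZ : M.PiTemp} (hσZ : M.inclX σZ = εZ) (hodd : Odd (Multiplicative.toAdd (M.toZ σZ)))
    (x : M.toThetaSetting.H1 M.toThetaSetting.GtpYdd) :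
    ∃ σ₁ : M.PiTemp, M.inclX σ₁ ∈ M.dotX εZ ∧ Multiplicative.toAdd (M.toZ σ₁) = 1 ∧
      (haveI := hC.GtpYdd_normal
       M.thetaOrbit hC εZ x =
        Set.range fun a : ℤ => ContH1.conj M.toTheta M.toThetaSetting.DeltaTheta (σ₁ ^ a) x) := by
  obtain ⟨σ₁, hσ₁X, hσ₁Z, hgen⟩ := exists_orbit_generator hσZ hodd
  exact ⟨σ₁, hσ₁X, hσ₁Z, thetaOrbit_eq_range_conj_zpow hC εZ hσ₁X hgen x⟩

end MuTwoSetting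

end Literature.AnabelianGeometry.EtaleTheta
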